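import Literature.AnabelianGeometry.EtaleTheta.Discharge.Sec5AodotCharacteristicOfTemperoid
import Literature.AnabelianGeometry.SemiGraphs.BTempResEquiv
import Literature.AnabelianGeometry.SemiGraphs.TemperedLevelStability
import Literature.AlgebraicGeometry.Frobenioids.CoproductCompletionConnected
import Mathlib.CategoryTheory.ObjectProperty.Equivalence

/-!
# [EtTh] §5 p.322–323 «`A_⊚^bs` is characteristic» is EQUIVALENT to «`H_⊙ ⊆ Π^tp_X` is topologically characteristic» —
# the anabelian input of FILE 1 (`Sec5AodotCharacteristicOfTemperoid`, p442771) is SHARP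

S. Mochizuki, *The étale theta function and its Frobenioid-theoretic manifestations*, Publ. RIMS **45** (2009)
[MochizukiEtTh2009], §5 p.322–323 (PDF pp.96–97): «this `A_⊚^bs` is "characteristic" — that is to say, it is preserved by
arbitrary self-equivalences of `D` [cf. Propositions 2.4, 2.6]»; S. Mochizuki, *Semi-graphs of anabelioids* [MochizukiSemiAnbd2006],
Rmk. 3.1.2 pp.33–34 («any continuous homomorphism `Π → Π'` determines … `B^temp(Π) → B^temp(Π')`»; for an isomorphism `γ` of
topological groups, `B^temp(γ)` is a self-equivalence — abc-iut's `BTemp.resEquiv`).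

abc-iut cell, layer L2, ROW R251 «hchar PRODUCER» (seat abc-iut-w4-d008 gen 5), FILE 4 — the CONVERSE of FILE 1.  PROOF-ONLY.
FILE 1 proved: `IsTopCharacteristic X.Pi H_⊙ ⟹ ∀ Θ : B^temp(Π^tp_X)⁰ ≌ B^temp(Π^tp_X)⁰, Θ(A_⊙^bs) ≅ A_⊙^bs`.  Here: the self-equivalence
`B^temp(γ)⁰` of the connected temperoid induced by an automorphism `γ` of the topological group `Π^tp_X` (Mathlib's
`Equivalence.congrFullSubcategory` of `BTemp.resEquiv γ`; connected objects are exactly preserved) maps the Galois object `Π/N` to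
`Π/γ⁻¹(N)`, so «`Θ(A_⊙^bs) ≅ A_⊙^bs` for every `Θ`» forces `γ⁻¹(H_⊙) = H_⊙` for every `γ` (abc-iut-L3's
`Subgroup.comap_eq_of_res_quotientObj_iso`, [SemiAnbd] Rmk. 3.1.2) — i.e. `H_⊙` IS topologically characteristic:
* `GaloisObjects.connectedObjects_inverseImage_res_eq` — `B^temp(γ)` of an isomorphism preserves AND reflects connected objects;
* `GaloisObjects.isTopCharacteristic_of_forall_connectedPart_equivalence` — for a Galois object `A` of `B^temp(Π)⁰`:
  (∀ Θ, `Θ A ≅ A`) ⟹ `IsTopCharacteristic Π N_A`; with FILE 1: `…_iff_…`;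
* `BiKummerSetting.hchar_mkOfConnectedTemperoid_iff_isTopCharacteristic` — **over `B^temp(Π^tp_X)⁰`, print's clause `hchar` (for all
  self-equivalences of `D`) holds IF AND ONLY IF `H_⊙` is characteristic in the topological group `Π^tp_X`**: the binder cannot be
  weakened below the [EtTh] Prop. 2.4 clause, and needs nothing beyond it.
HONEST FRAMING: kernel-checked category/group theory over abc-iut-L3's temperoid vocabulary; nothing here bears on [IUTchIII] Cor. 3.12
— no side is taken; typed ≠ proved for the genuine data (the anabelian clause itself stays a hypothesis BY NAME).
-/

noncomputable section

open CategoryTheory Topology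

namespace Literature.AnabelianGeometry.SemiGraphs

namespace GaloisObjects

open Literature.AlgebraicGeometry.Frobenioids (IsConnectedObj connectedObjects ConnectedPart)
open Literature.AlgebraicGeometry.Frobenioids.QuasiTemperoid.BTempConnected

universe u

variable {G : Type u} [Group G] [TopologicalSpace G] [IsTopologicalGroup G]

omit [IsTopologicalGroup G] in
/-- **`B^temp(γ)` of an ISOMORPHISM of topological groups preserves and reflects connected objects** (one orbit stays one
orbit; `γ` is onto both ways): the inverse image of the property "connected" under `B^temp(γ)` is "connected".
[cite: MochizukiSemiAnbd2006, Rmk 3.1.2 p.34] -/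
theorem connectedObjects_inverseImage_res_eq (γ : G ≃ₜ* G) :
    (connectedObjects (BTemp G)).inverseImage (BTemp.res (γ : G →ₜ* G)) = connectedObjects (BTemp G) := by
  ext X
  change IsConnectedObj ((BTemp.res (γ : G →ₜ* G)).obj X) ↔ IsConnectedObj X
  refine ⟨fun h => ?_, fun h => isConnectedObj_res (γ : G →ₜ* G) γ.surjective X h⟩
  -- `X ≅ B^temp(γ⁻¹)(B^temp(γ)(X))` and `B^temp(γ⁻¹)` preserves connected objects
  exact isConnectedObj_of_iso ((BTemp.resEquiv γ).unitIso.app X)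
    (isConnectedObj_res (γ.symm : G →ₜ* G) γ.symm.surjective _ h)

/-- **CONVERSE of FILE 1, §4: if every self-equivalence of the connected temperoid `B^temp(Π)⁰` maps the Galois object `A` to an
isomorph of `A`, then `N_A = Ker(Π ↠ Aut(A))` is characteristic in the topological group `Π`.**  Test the hypothesis on
`Θ := B^temp(γ)⁰` (`γ` an automorphism of the topological group `Π`): `A ≅ Π/N_A`, `B^temp(γ)(Π/N_A) ≅ B^temp(γ)(A) ≅ A ≅ Π/N_A`
forces `γ⁻¹(N_A) = N_A` ([SemiAnbd] Rmk. 3.1.2, abc-iut-L3's `Subgroup.comap_eq_of_res_quotientObj_iso`).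
[cite: MochizukiSemiAnbd2006, Rmk 3.1.2 p.33–34] -/
theorem isTopCharacteristic_of_forall_connectedPart_equivalence (hG : IsTempered G) (A : ConnectedPart (BTemp G))
    (hA : IsGaloisObj A.obj) (h : ∀ Θ : ConnectedPart (BTemp G) ≌ ConnectedPart (BTemp G), Nonempty (Θ.functor.obj A ≅ A)) :
    Literature.AnabelianGeometry.EtaleTheta.IsTopCharacteristic G (galoisSurjOf hG A.obj hA).ker := by
  -- every `γ` stabilises `N_A` under PREIMAGE
  have hcomap : ∀ γ : G ≃ₜ* G, (galoisSurjOf hG A.obj hA).ker.comap (γ : G →ₜ* G).toMonoidHom = (galoisSurjOf hG A.obj hA).ker := by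
    intro γ
    haveI : (connectedObjects (BTemp G)).IsClosedUnderIsomorphisms := ⟨fun e hX => IsConnectedObj.of_iso hX e⟩
    -- the self-equivalence `B^temp(γ)⁰` of the connected part
    let Θ : ConnectedPart (BTemp G) ≌ ConnectedPart (BTemp G) :=
      (BTemp.resEquiv γ).congrFullSubcategory (connectedObjects_inverseImage_res_eq γ)
    obtain ⟨i⟩ := h Θ
    -- underlying `B^temp(Π)`-isomorphism `B^temp(γ)(A) ≅ A`
    have i' : (BTemp.res (γ : G →ₜ* G)).obj A.obj ≅ A.obj := (connectedObjects (BTemp G)).ι.mapIso i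
    -- `A ≅ Π/N_A`
    have e := galoisIso hG A.obj hA
    rw [ker_galoisSurjOf]
    exact Subgroup.comap_eq_of_res_quotientObj_iso hG (γ : G →ₜ* G) (galoisQuot hG A.obj hA).toSubgroup
      (galoisQuot hG A.obj hA).isOpen' ⟨(BTemp.res (γ : G →ₜ* G)).mapIso e.symm ≪≫ i' ≪≫ e⟩
  intro γ
  have h1 := hcomap γ.symm
  have e2 : (galoisSurjOf hG A.obj hA).ker.comap (γ.symm : G →ₜ* G).toMonoidHom =
      (galoisSurjOf hG A.obj hA).ker.comap γ.symm.toMulEquiv.toMonoidHom := rfl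
  rw [e2, Subgroup.comap_equiv_eq_map_symm'] at h1
  exact h1

/-- **«`A` is preserved by every self-equivalence of `B^temp(Π)⁰`» ⟺ «`N_A` is characteristic in the topological group `Π`»**
(`Π` tempered, Galois-countable; `A` Galois) — FILE 1 §4 and its converse. [cite: MochizukiEtTh2009, §5 p.322–323 (PDF pp.96–97)] -/
theorem forall_connectedPart_equivalence_iff_isTopCharacteristic [SecondCountableTopology G] (hG : IsTempered G)
    (A : ConnectedPart (BTemp G)) (hA : IsGaloisObj A.obj) :
    (∀ Θ : ConnectedPart (BTemp G) ≌ ConnectedPart (BTemp G), Nonempty (Θ.functor.obj A ≅ A)) ↔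
      Literature.AnabelianGeometry.EtaleTheta.IsTopCharacteristic G (galoisSurjOf hG A.obj hA).ker :=
  ⟨isTopCharacteristic_of_forall_connectedPart_equivalence hG A hA,
    fun hc Θ => nonempty_iso_of_connectedPart_equivalence_of_isTopCharacteristic hG Θ A hA hc⟩

end GaloisObjects

end Literature.AnabelianGeometry.SemiGraphs

/-! ### Over `B^temp(Π^tp_X)⁰`: `hchar ⟺ IsTopCharacteristic X.Pi H_⊙` -/

namespace Literature.AnabelianGeometry.EtaleTheta

open Literature.AlgebraicGeometry.Frobenioids Literature.AnabelianGeometry.SemiGraphs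
  Literature.AnabelianGeometry.SemiGraphs.GaloisObjects

namespace BiKummerSetting

universe u₀ v₀ w

variable {K : Type u₀} [Field K] (X : SemiGraphs.TemperedArithmeticGroup.{u₀} K) {D₀ : Type u₀} [Category.{v₀} D₀]
  {V : FrdIMonoidStub.{w}} {T₀ : RealifiedDivisorMonoids (D₀ := D₀) V}
  {VD : FrdICatStub.{u₀ + 1, u₀, w} (ConnectedPart (BTemp X.Pi))}
  (tf : TemperedFrobenioid T₀ (ConnectedPart (BTemp X.Pi)) VD) (hZ : tf.monoidType = MonoidType.Z)
  (hP : ∀ A : (ConnectedPart (BTemp X.Pi))ᵒᵖ, IsPerfect (tf.Φ.carrier A))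
  (NH : Subgroup (Field.absoluteGaloisGroup K) → tf.category → ℕ+ → Prop)
  (A₀ : tf.category) (hA₀ : PreFrobenioid.IsFrobeniusTrivial tf.toElem A₀) (hA₀' : SemiGraphs.IsGaloisObj A₀.base.obj)

/-- **CONVERSE of FILE 1's `hchar` producer over `B^temp(Π^tp_X)⁰`**: if `A_⊙^bs` is preserved by every self-equivalence of `D`, then
`H_⊙` is characteristic in the topological group `Π^tp_X` (test on `B^temp(γ)⁰`, `γ ∈ Aut(Π^tp_X)`).
[cite: MochizukiEtTh2009, §5 p.322–323 (PDF pp.96–97)] -/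
theorem isTopCharacteristic_hodot_of_hchar_mkOfConnectedTemperoid
    (h : ∀ Θ : ConnectedPart (BTemp X.Pi) ≌ ConnectedPart (BTemp X.Pi), IsIsomorph (Θ.functor.obj A₀.base) A₀.base) :
    IsTopCharacteristic X.Pi (mkOfConnectedTemperoid X tf hZ hP NH A₀ hA₀ hA₀').Hodot := by
  have hker : (mkOfConnectedTemperoid X tf hZ hP NH A₀ hA₀ hA₀').Hodot = (galoisSurjOf X.isTempered A₀.base.obj hA₀').ker :=
    ker_mkOfConnectedTemperoid_galoisSurj X tf hZ hP NH A₀ hA₀ hA₀' A₀.base hA₀'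
  rw [hker]
  exact isTopCharacteristic_of_forall_connectedPart_equivalence X.isTempered A₀.base hA₀' h

/-- **[EtTh] §5 p.322–323 over the genuine base, SHARP FORM: «`A_⊚^bs` is preserved by arbitrary self-equivalences of `D`» holds IF
AND ONLY IF `H_⊙ ⊆ Π^tp_X` is characteristic in the topological group** — the binder `hchar` of abc-iut-L2-t9's
`exists_thm44Hyp_mkOfModelCanonical_treeCatVocab` is EXACTLY the [EtTh] Prop. 2.4 clause in abc-iut-w4-d034's currency, no more, no less.
[cite: MochizukiEtTh2009, §5 p.322–323 (PDF pp.96–97)] -/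
theorem hchar_mkOfConnectedTemperoid_iff_isTopCharacteristic :
    (∀ Θ : ConnectedPart (BTemp X.Pi) ≌ ConnectedPart (BTemp X.Pi), IsIsomorph (Θ.functor.obj A₀.base) A₀.base) ↔
      IsTopCharacteristic X.Pi (mkOfConnectedTemperoid X tf hZ hP NH A₀ hA₀ hA₀').Hodot :=
  ⟨isTopCharacteristic_hodot_of_hchar_mkOfConnectedTemperoid X tf hZ hP NH A₀ hA₀ hA₀',
    hchar_mkOfConnectedTemperoid_of_isTopCharacteristic X tf hZ hP NH A₀ hA₀ hA₀'⟩

section Setting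

variable {p : ℕ} [Fact p.Prime] {D : ThetaSetting p} {E : D.EtaleThetaData} {l : ℕ} (C : E.DoubleUnderline l)
  (e : D.toTemperedCurve.GroupLevelData) {N : ℕ+} (μ : D.CyclotomeMod l N) (hC : D.Compat) (hS : D.Sec2Hyps)
  {D₀ : Type} [Category.{v₀} D₀] {V : FrdIMonoidStub.{0}} {T₀ : RealifiedDivisorMonoids (D₀ := D₀) V}
  {VD : FrdICatStub.{1, 0, 0} (ConnectedPart (BTemp (C.temperedArithmeticGroup e).Pi))}
  (tf : TemperedFrobenioid T₀ (ConnectedPart (BTemp (C.temperedArithmeticGroup e).Pi)) VD) (hZ : tf.monoidType = MonoidType.Z)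
  (hP : ∀ A : (ConnectedPart (BTemp (C.temperedArithmeticGroup e).Pi))ᵒᵖ, IsPerfect (tf.Φ.carrier A))
  (NH : Subgroup (Field.absoluteGaloisGroup D.K) → tf.category → ℕ+ → Prop)

/-- **THE SETTING, SHARP FORM**: over `B^temp(Π^tp_X̲̲)⁰` with `A_⊙^bs := Ÿ̲̲` (abc-iut-L2-t4's `mkOfThetaSettingYdd`), print's «`A_⊚^bs` is
preserved by arbitrary self-equivalences of `D`» holds IF AND ONLY IF «every topological automorphism of `Π^tp_X̲̲` stabilises `Π^tp_Ÿ̲̲`»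
(`IsTopCharacteristic Π^tp_X̲̲ Π^tp_Ÿ̲̲` = abc-iut-L6-t1's (H1) / the [EtTh] Prop. 2.4 `Ÿ`-clause; `H_⊙ = Π^tp_Ÿ̲̲` by `Hodot_mkOfThetaSettingYdd`).
[cite: MochizukiEtTh2009, §5 p.322–323 (PDF pp.96–97); Prop 2.4 p.38] -/
theorem hchar_mkOfThetaSettingYdd_iff_isTopCharacteristic :
    (∀ Θ : ConnectedPart (BTemp (C.temperedArithmeticGroup e).Pi) ≌ ConnectedPart (BTemp (C.temperedArithmeticGroup e).Pi),
      IsIsomorph (Θ.functor.obj (mkOfThetaSettingYdd C e μ hC hS tf hZ hP NH).Aodot.base)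
        (mkOfThetaSettingYdd C e μ hC hS tf hZ hP NH).Aodot.base) ↔
      IsTopCharacteristic C.Huu (D.GtpYdd.subgroupOf C.Huu) := by
  have h := hchar_mkOfConnectedTemperoid_iff_isTopCharacteristic (C.temperedArithmeticGroup e) tf hZ hP NH
    (mkOfThetaSettingYdd C e μ hC hS tf hZ hP NH).Aodot (mkOfThetaSettingYdd C e μ hC hS tf hZ hP NH).isFrobeniusTrivial_Aodot
    (mkOfThetaSettingYdd C e μ hC hS tf hZ hP NH).isGalois_Aodot
  have hH : (mkOfConnectedTemperoid (C.temperedArithmeticGroup e) tf hZ hP NH (mkOfThetaSettingYdd C e μ hC hS tf hZ hP NH).Aodot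
      (mkOfThetaSettingYdd C e μ hC hS tf hZ hP NH).isFrobeniusTrivial_Aodot (mkOfThetaSettingYdd C e μ hC hS tf hZ hP NH).isGalois_Aodot).Hodot =
        D.GtpYdd.subgroupOf C.Huu :=
    Hodot_mkOfThetaSettingYdd C e μ hC hS tf hZ hP NH
  rw [hH] at h
  exact h

end Setting

end BiKummerSetting

end Literature.AnabelianGeometry.EtaleTheta

end
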